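import Summits.CriticalPhenomena.Ising3DConformalLimit.Theses.FKParityRobustness
import Summits.CriticalPhenomena.Ising3DConformalLimit.Theorems.FKParityRobustnessDepletionBoundClusters
import Summits.CriticalPhenomena.Ising3DConformalLimit.Theorems.FKParityRobustnessDepletionBoundHTE
import Literature.Probability.LatticeModels.ModifiedSimonInequality
import HarnessLib

/-!
# Item `DepletionBound` (stmt-CriticalPhenomena-14628) of route `FKParityRobustness`: the depletion
# (shadow) bound for the source cluster of a sourced loop-O(1) configuration

On every finite graph `G = (V, E)`, for `β ≥ 0`, `t = tanh β`, vertices `x, y` and a vertex set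
`S ∌ x, y`:

  `(Σ_{F ∈ 𝒯_{xy}(G), V(K_x(F)) ∩ S = ∅} t^{|F|}) · ⟨σ_xσ_y⟩^free_{G}`
      `≤ Z^{xy}_t(G) · ⟨σ_xσ_y⟩^free_{G, couplings at S off}`,

i.e. `ℓ^{xy}_G[the source cluster avoids S] ≤ ⟨σ_xσ_y⟩_{G∖S} / ⟨σ_xσ_y⟩_G`, where `𝒯_{xy}(G)` are
the `T`-joins of `G` with terminal set `{x, y}` (`tJoins`), `K_x(F)` is the `F`-component of `x`,
`Z^{xy}_t = loopO1PartitionFunction G t {x,y}` and `⟨·⟩^free_{G,Λ} = isingCorr G Λ β 0 .free`.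

Proof (the planner's sketch, verbatim).  Fibre the `T`-joins over their source cluster
`K = K_x(F)`: `F ↦ (K, F ∖ K)` is a bijection onto
`{self-clustered K ∋ x with ∂K = {x,y}, V(K) ∩ S = ∅} × {even subgraphs of G[Λ_K]}`,
`Λ_K = V ∖ V(K)` (`fibre_sum` of the companion file `…DepletionBoundClusters`), so that
`Σ_{avoid} t^{|F|} = Σ_K t^{|K|} g_{Λ_K}(∅)` (`fibre_eval`) and, over the SAME index set,
`g_{V∖S}({x,y}) = Σ_K t^{|K|} g_{Λ_K∖S}(∅)` (`hteSum_sdiff_pair_eq`), with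
`g_Λ(A) = hteSum G Λ t A = Σ_{F ⊆ ℰ_Λ, ∂F = A} t^{|F|}`.  Termwise,
`g_{Λ_K}(∅) g_{V∖S}(∅) ≤ g_{Λ_K∖S}(∅) g_V(∅)` is the vertex-set supermodularity of
`Λ ↦ log g_Λ(∅)` (`hteSum_empty_supermodular` of `…DepletionBoundHTE`, transported from the tree's
`ghteSum_empty_supermodular` = Aizenman–Fernández 1986 Claim (4.15) / Aizenman 1982 Lemma 9.3),
since `Λ_K ⊇ S`.  Summing gives `sum_avoid_mul_hteSum_le`; the item follows by the high-temperature
expansion `⟨σ_A⟩^free_Λ = g_Λ(A)/g_Λ(∅)` (`isingCorr_free_eq_hteSum_div`) and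
`Z^{xy}_t = g_V({x,y})` (`loopO1PartitionFunction_eq_hteSum`).  The degenerate case `x = y`
(no `T`-join, `Z^{x} = 0`) is `0 ≤ 0` and needs no separate treatment.
-/

noncomputable section

namespace Summit.CriticalPhenomena.Ising3DConformalLimit.Theorems.DepletionBound

open scoped Classical
open Finset
open Literature.Probability.LatticeModels

/-! ### The `x`-cluster of a `T`-join with terminal set `{x, y}` -/

section Pair

variable {V : Type*} [Fintype V] [DecidableEq V] (G : SimpleGraph V) [DecidableRel G.Adj]

/-- **The strand exists**: in a `T`-join with terminal set `{x, y}` the terminal `y` is reachable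
from `x` (handshake inside the `x`-cluster). -/
theorem rch_of_mem_tJoins_pair {x y : V} {F : Finset (Sym2 V)}
    (hF : F ∈ tJoins G Set.univ {x, y}) : (SimpleGraph.fromEdgeSet ((F : Finset (Sym2 V)) : Set (Sym2 V))).Reachable x y := by
  by_contra hn
  rw [mem_tJoins_univ] at hF
  obtain ⟨hFG, hFodd⟩ := hF
  have hdiag : ∀ e ∈ (Finset.filter (fun e => ∃ v ∈ e, (SimpleGraph.fromEdgeSet ((F : Finset (Sym2 V)) : Set (Sym2 V))).Reachable x v) F), ¬ e.IsDiag := fun e he =>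
    SimpleGraph.not_isDiag_of_mem_edgeSet G
      (SimpleGraph.mem_edgeFinset.1 (hFG (filter_cluster_subset F x he)))
  have heven := even_card_odd_degree hdiag
  have hO : (univ.filter fun v => Odd #(Finset.filter (fun e => v ∈ e) ((Finset.filter (fun e => ∃ v ∈ e, (SimpleGraph.fromEdgeSet ((F : Finset (Sym2 V)) : Set (Sym2 V))).Reachable x v) F)))) = {x} := by
    ext v
    rw [mem_filter, mem_singleton]
    by_cases hv : (SimpleGraph.fromEdgeSet ((F : Finset (Sym2 V)) : Set (Sym2 V))).Reachable x v
    · rw [odd_deg_cluster_iff hv, hFodd v, mem_insert, mem_singleton]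
      constructor
      · rintro ⟨-, h | h⟩
        · exact h
        · exact absurd (h ▸ hv) hn
      · intro h
        exact ⟨mem_univ _, Or.inl h⟩
    · rw [deg_cluster_eq_zero hv]
      constructor
      · rintro ⟨-, h⟩
        exact absurd h Nat.not_odd_zero
      · rintro rfl
        exact absurd (rch_refl F v) hv
  rw [hO, card_singleton] at heven
  exact Nat.not_even_one heven

/-- The `x`-cluster of a `T`-join with terminal set `{x, y}` lies in `E(G)`, is self-clustered and
has odd-degree set `{x, y}`. -/
theorem cluster_props {x y : V} {F : Finset (Sym2 V)} (hF : F ∈ tJoins G Set.univ {x, y}) :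
    (Finset.filter (fun e => ∃ v ∈ e, (SimpleGraph.fromEdgeSet ((F : Finset (Sym2 V)) : Set (Sym2 V))).Reachable x v) F) ⊆ G.edgeFinset ∧ (Finset.filter (fun e => ∃ v ∈ e, (SimpleGraph.fromEdgeSet (((Finset.filter (fun e => ∃ v ∈ e, (SimpleGraph.fromEdgeSet ((F : Finset (Sym2 V)) : Set (Sym2 V))).Reachable x v) F) : Finset (Sym2 V)) : Set (Sym2 V))).Reachable x v) ((Finset.filter (fun e => ∃ v ∈ e, (SimpleGraph.fromEdgeSet ((F : Finset (Sym2 V)) : Set (Sym2 V))).Reachable x v) F))) = (Finset.filter (fun e => ∃ v ∈ e, (SimpleGraph.fromEdgeSet ((F : Finset (Sym2 V)) : Set (Sym2 V))).Reachable x v) F) ∧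
      ∀ v, Odd #(Finset.filter (fun e => v ∈ e) ((Finset.filter (fun e => ∃ v ∈ e, (SimpleGraph.fromEdgeSet ((F : Finset (Sym2 V)) : Set (Sym2 V))).Reachable x v) F))) ↔ v ∈ ({x, y} : Finset V) := by
  have hxy : (SimpleGraph.fromEdgeSet ((F : Finset (Sym2 V)) : Set (Sym2 V))).Reachable x y := rch_of_mem_tJoins_pair G hF
  rw [mem_tJoins_univ] at hF
  obtain ⟨hFG, hFodd⟩ := hF
  refine ⟨(filter_cluster_subset F x).trans hFG, filter_cluster_idem F x, fun v => ?_⟩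
  by_cases hv : (SimpleGraph.fromEdgeSet ((F : Finset (Sym2 V)) : Set (Sym2 V))).Reachable x v
  · rw [odd_deg_cluster_iff hv, hFodd v]
  · rw [deg_cluster_eq_zero hv, mem_insert, mem_singleton]
    constructor
    · intro h
      exact absurd h Nat.not_odd_zero
    · rintro (rfl | rfl)
      · exact absurd (rch_refl F v) hv
      · exact absurd hxy hv

/-- **Outer decomposition.** The sum over the `T`-joins of `{x, y}` whose `x`-cluster avoids `S`
is the sum over the cluster index set of the fibre sums. -/
theorem sum_avoid_eq_sum_fibres (x y : V) (S : Finset V) (g : Finset (Sym2 V) → ℝ) :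
    ∑ F ∈ (tJoins G Set.univ {x, y}).filter (fun F => ∀ v ∈ S, ¬ (SimpleGraph.fromEdgeSet ((F : Finset (Sym2 V)) : Set (Sym2 V))).Reachable x v), g F =
      ∑ K ∈ (Finset.filter (fun K => (Finset.filter (fun e => ∃ v ∈ e, (SimpleGraph.fromEdgeSet ((K : Finset (Sym2 V)) : Set (Sym2 V))).Reachable x v) K) = K ∧ (∀ v, Odd #(Finset.filter (fun e => v ∈ e) K) ↔ v ∈ ({x, y} : Finset V)) ∧ ∀ v ∈ S, ¬ (SimpleGraph.fromEdgeSet ((K : Finset (Sym2 V)) : Set (Sym2 V))).Reachable x v) (SimpleGraph.edgeFinset G).powerset),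
        ∑ F ∈ (tJoins G Set.univ {x, y}).filter (fun F => (Finset.filter (fun e => ∃ v ∈ e, (SimpleGraph.fromEdgeSet ((F : Finset (Sym2 V)) : Set (Sym2 V))).Reachable x v) F) = K), g F := by
  have hmaps : ∀ F ∈ (tJoins G Set.univ {x, y}).filter (fun F => ∀ v ∈ S, ¬ (SimpleGraph.fromEdgeSet ((F : Finset (Sym2 V)) : Set (Sym2 V))).Reachable x v),
      (Finset.filter (fun e => ∃ v ∈ e, (SimpleGraph.fromEdgeSet ((F : Finset (Sym2 V)) : Set (Sym2 V))).Reachable x v) F) ∈ (Finset.filter (fun K => (Finset.filter (fun e => ∃ v ∈ e, (SimpleGraph.fromEdgeSet ((K : Finset (Sym2 V)) : Set (Sym2 V))).Reachable x v) K) = K ∧ (∀ v, Odd #(Finset.filter (fun e => v ∈ e) K) ↔ v ∈ ({x, y} : Finset V)) ∧ ∀ v ∈ S, ¬ (SimpleGraph.fromEdgeSet ((K : Finset (Sym2 V)) : Set (Sym2 V))).Reachable x v) (SimpleGraph.edgeFinset G).powerset) := by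
    intro F hF
    rw [mem_filter] at hF
    obtain ⟨hF, havoid⟩ := hF
    obtain ⟨h1, h2, h3⟩ := cluster_props G hF
    rw [mem_filter, mem_powerset]
    exact ⟨h1, h2, h3, fun v hv => by rw [rch_cluster_iff]; exact havoid v hv⟩
  rw [← Finset.sum_fiberwise_of_maps_to hmaps g]
  refine Finset.sum_congr rfl fun K hK => ?_
  apply Finset.sum_congr ?_ (fun _ _ => rfl)
  rw [mem_filter] at hK
  obtain ⟨-, -, -, hKS⟩ := hK
  ext F
  simp only [mem_filter]
  constructor
  · rintro ⟨⟨hF, -⟩, hcl⟩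
    exact ⟨hF, hcl⟩
  · rintro ⟨hF, hcl⟩
    refine ⟨⟨hF, fun v hv => ?_⟩, hcl⟩
    rw [← rch_cluster_iff, hcl]
    exact hKS v hv

/-- Members of the cluster index set lie inside `ℰ_{univ ∖ S}` (every endpoint is reachable, hence
not in `S`). -/
theorem subset_edgesIn_sdiff_of_mem_index {x y : V} {S : Finset V} {K : Finset (Sym2 V)}
    (hK : K ∈ (Finset.filter (fun K => (Finset.filter (fun e => ∃ v ∈ e, (SimpleGraph.fromEdgeSet ((K : Finset (Sym2 V)) : Set (Sym2 V))).Reachable x v) K) = K ∧ (∀ v, Odd #(Finset.filter (fun e => v ∈ e) K) ↔ v ∈ ({x, y} : Finset V)) ∧ ∀ v ∈ S, ¬ (SimpleGraph.fromEdgeSet ((K : Finset (Sym2 V)) : Set (Sym2 V))).Reachable x v) (SimpleGraph.edgeFinset G).powerset)) : K ⊆ edgesIn G (univ \ S) := by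
  rw [mem_filter, mem_powerset] at hK
  obtain ⟨hKG, hKself, -, hKS⟩ := hK
  intro e he
  rw [mem_edgesIn_iff]
  refine ⟨SimpleGraph.mem_edgeFinset.1 (hKG he), fun v hv => mem_sdiff.2 ⟨mem_univ _, fun hvS => ?_⟩⟩
  exact hKS v hvS (rch_of_mem_of_self hKself he hv)

/-- **Fibre evaluation, full graph**: over the fibre of `K`, `Σ t^{|F|} = t^{|K|} · g_{Λ_K}(∅)`. -/
theorem fibre_eval {x y : V} {S : Finset V} {K : Finset (Sym2 V)} (hK : K ∈ (Finset.filter (fun K => (Finset.filter (fun e => ∃ v ∈ e, (SimpleGraph.fromEdgeSet ((K : Finset (Sym2 V)) : Set (Sym2 V))).Reachable x v) K) = K ∧ (∀ v, Odd #(Finset.filter (fun e => v ∈ e) K) ↔ v ∈ ({x, y} : Finset V)) ∧ ∀ v ∈ S, ¬ (SimpleGraph.fromEdgeSet ((K : Finset (Sym2 V)) : Set (Sym2 V))).Reachable x v) (SimpleGraph.edgeFinset G).powerset))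
    (t : ℝ) :
    ∑ F ∈ (tJoins G Set.univ {x, y}).filter (fun F => (Finset.filter (fun e => ∃ v ∈ e, (SimpleGraph.fromEdgeSet ((F : Finset (Sym2 V)) : Set (Sym2 V))).Reachable x v) F) = K), t ^ #F =
      t ^ #K * hteSum G (Finset.filter (fun v => ¬ (SimpleGraph.fromEdgeSet ((K : Finset (Sym2 V)) : Set (Sym2 V))).Reachable x v) Finset.univ) t ∅ := by
  rw [mem_filter, mem_powerset] at hK
  obtain ⟨hKG, hKself, hKodd, -⟩ := hK
  have hfib := fibre_sum G hKG hKself hKodd (T := ∅) (empty_subset _) (fun F => t ^ #F)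
  rw [union_empty] at hfib
  rw [hfib]
  have hsummand : ∀ R ∈ (edgesIn G (Finset.filter (fun v => ¬ (SimpleGraph.fromEdgeSet ((K : Finset (Sym2 V)) : Set (Sym2 V))).Reachable x v) Finset.univ)).powerset.filter (fun R => oddVerts (Finset.filter (fun v => ¬ (SimpleGraph.fromEdgeSet ((K : Finset (Sym2 V)) : Set (Sym2 V))).Reachable x v) Finset.univ) R = ∅),
      t ^ #(K ∪ R) = t ^ #K * t ^ #R := by
    intro R hR
    rw [mem_filter, mem_powerset] at hR
    have havoid : ∀ e ∈ R, ∀ v ∈ e, ¬ (SimpleGraph.fromEdgeSet ((K : Finset (Sym2 V)) : Set (Sym2 V))).Reachable x v := fun e he v hv =>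
      mem_dVol.1 ((mem_edgesIn_iff.1 (hR.1 he)).2 v hv)
    rw [card_union_of_disjoint (disjoint_of_avoid hKself havoid), pow_add]
  rw [Finset.sum_congr rfl hsummand, ← Finset.mul_sum]
  rfl

/-- Even subgraphs of the depleted volume avoiding `S` are the even subgraphs of `Λ_K ∖ S`. -/
theorem filter_even_subset_eq (Λ S : Finset V) :
    ((edgesIn G Λ).powerset.filter (fun R => oddVerts Λ R = ∅)).filter
        (fun R => R ⊆ edgesIn G (univ \ S)) =
      (edgesIn G (Λ \ S)).powerset.filter (fun R => oddVerts (Λ \ S) R = ∅) := by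
  ext R
  simp only [mem_filter, mem_powerset]
  constructor
  · rintro ⟨⟨hR1, hR2⟩, hR3⟩
    refine ⟨fun e he => ?_, ?_⟩
    · rw [mem_edgesIn_iff]
      obtain ⟨heG, h1⟩ := mem_edgesIn_iff.1 (hR1 he)
      exact ⟨heG, fun v hv => mem_sdiff.2 ⟨h1 v hv, (mem_sdiff.1 ((mem_edgesIn_iff.1 (hR3 he)).2 v hv)).2⟩⟩
    · rw [oddVerts, filter_eq_empty_iff]
      intro v hv hodd
      rw [oddVerts, filter_eq_empty_iff] at hR2
      exact hR2 (mem_sdiff.1 hv).1 hodd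
  · rintro ⟨hR1, hR2⟩
    refine ⟨⟨fun e he => edgesIn_mono G sdiff_subset (hR1 he), ?_⟩,
      fun e he => edgesIn_mono G (sdiff_subset_sdiff (subset_univ _) subset_rfl) (hR1 he)⟩
    rw [oddVerts, filter_eq_empty_iff]
    intro v hv hodd
    by_cases hvS : v ∈ S
    · -- a vertex of `S` lies on no edge of `R`
      have h0 : #(Finset.filter (fun e => v ∈ e) R) = 0 := by
        rw [card_eq_zero, filter_eq_empty_iff]
        intro e he hve
        exact (mem_sdiff.1 ((mem_edgesIn_iff.1 (hR1 he)).2 v hve)).2 hvS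
      rw [h0] at hodd
      exact Nat.not_odd_zero hodd
    · rw [oddVerts, filter_eq_empty_iff] at hR2
      exact hR2 (mem_sdiff.2 ⟨hv, hvS⟩) hodd

/-- **Fibre evaluation, couplings at `S` off**: over the fibre of `K`, the sum of `t^{|F|}` over
the `T`-joins avoiding `S` altogether is `t^{|K|} · g_{Λ_K ∖ S}(∅)`. -/
theorem fibre_eval_sdiff {x y : V} {S : Finset V} {K : Finset (Sym2 V)}
    (hK : K ∈ (Finset.filter (fun K => (Finset.filter (fun e => ∃ v ∈ e, (SimpleGraph.fromEdgeSet ((K : Finset (Sym2 V)) : Set (Sym2 V))).Reachable x v) K) = K ∧ (∀ v, Odd #(Finset.filter (fun e => v ∈ e) K) ↔ v ∈ ({x, y} : Finset V)) ∧ ∀ v ∈ S, ¬ (SimpleGraph.fromEdgeSet ((K : Finset (Sym2 V)) : Set (Sym2 V))).Reachable x v) (SimpleGraph.edgeFinset G).powerset)) (t : ℝ) :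
    ∑ F ∈ (tJoins G Set.univ {x, y}).filter (fun F => (Finset.filter (fun e => ∃ v ∈ e, (SimpleGraph.fromEdgeSet ((F : Finset (Sym2 V)) : Set (Sym2 V))).Reachable x v) F) = K),
        (if F ⊆ edgesIn G (univ \ S) then t ^ #F else 0) =
      t ^ #K * hteSum G ((Finset.filter (fun v => ¬ (SimpleGraph.fromEdgeSet ((K : Finset (Sym2 V)) : Set (Sym2 V))).Reachable x v) Finset.univ) \ S) t ∅ := by
  have hKE : K ⊆ edgesIn G (univ \ S) := subset_edgesIn_sdiff_of_mem_index G hK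
  rw [mem_filter, mem_powerset] at hK
  obtain ⟨hKG, hKself, hKodd, -⟩ := hK
  have hfib := fibre_sum G hKG hKself hKodd (T := ∅) (empty_subset _)
    (fun F => if F ⊆ edgesIn G (univ \ S) then t ^ #F else 0)
  rw [union_empty] at hfib
  rw [hfib]
  have hsummand : ∀ R ∈ (edgesIn G (Finset.filter (fun v => ¬ (SimpleGraph.fromEdgeSet ((K : Finset (Sym2 V)) : Set (Sym2 V))).Reachable x v) Finset.univ)).powerset.filter (fun R => oddVerts (Finset.filter (fun v => ¬ (SimpleGraph.fromEdgeSet ((K : Finset (Sym2 V)) : Set (Sym2 V))).Reachable x v) Finset.univ) R = ∅),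
      (if K ∪ R ⊆ edgesIn G (univ \ S) then t ^ #(K ∪ R) else 0) =
        t ^ #K * (if R ⊆ edgesIn G (univ \ S) then t ^ #R else 0) := by
    intro R hR
    rw [mem_filter, mem_powerset] at hR
    have havoid : ∀ e ∈ R, ∀ v ∈ e, ¬ (SimpleGraph.fromEdgeSet ((K : Finset (Sym2 V)) : Set (Sym2 V))).Reachable x v := fun e he v hv =>
      mem_dVol.1 ((mem_edgesIn_iff.1 (hR.1 he)).2 v hv)
    by_cases hRS : R ⊆ edgesIn G (univ \ S)
    · rw [if_pos (union_subset hKE hRS), if_pos hRS,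
        card_union_of_disjoint (disjoint_of_avoid hKself havoid), pow_add]
    · rw [if_neg (fun h => hRS (subset_union_right.trans h)), if_neg hRS, mul_zero]
  rw [Finset.sum_congr rfl hsummand, ← Finset.mul_sum, ← Finset.sum_filter, filter_even_subset_eq]
  rfl

/-- **`g_{univ ∖ S}({x,y})` through the cluster index set**: the `T`-joins of `{x, y}` inside
`ℰ_{univ ∖ S}` are exactly the `T`-joins of `G` avoiding `S`, fibred over their `x`-cluster. -/
theorem hteSum_sdiff_pair_eq (x y : V) (S : Finset V) (t : ℝ) :
    hteSum G (univ \ S) t {x, y} =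
      ∑ K ∈ (Finset.filter (fun K => (Finset.filter (fun e => ∃ v ∈ e, (SimpleGraph.fromEdgeSet ((K : Finset (Sym2 V)) : Set (Sym2 V))).Reachable x v) K) = K ∧ (∀ v, Odd #(Finset.filter (fun e => v ∈ e) K) ↔ v ∈ ({x, y} : Finset V)) ∧ ∀ v ∈ S, ¬ (SimpleGraph.fromEdgeSet ((K : Finset (Sym2 V)) : Set (Sym2 V))).Reachable x v) (SimpleGraph.edgeFinset G).powerset), t ^ #K * hteSum G ((Finset.filter (fun v => ¬ (SimpleGraph.fromEdgeSet ((K : Finset (Sym2 V)) : Set (Sym2 V))).Reachable x v) Finset.univ) \ S) t ∅ := by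
  rw [← Finset.sum_congr rfl (fun K hK => fibre_eval_sdiff G hK t),
    ← sum_avoid_eq_sum_fibres G x y S, ← Finset.sum_filter]
  unfold hteSum
  refine Finset.sum_congr ?_ (fun _ _ => rfl)
  ext F
  simp only [mem_filter, mem_powerset, mem_tJoins_univ G]
  constructor
  · rintro ⟨hFE, hodd⟩
    -- terminals are off `S`
    have hoddv : ∀ v, v ∈ oddVerts (univ \ S) F ↔ v ∈ ({x, y} : Finset V) := fun v => by rw [hodd]
    simp only [oddVerts, mem_filter, mem_sdiff, mem_univ, true_and] at hoddv
    have hxS : x ∉ S := ((hoddv x).2 (by simp)).1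
    have hdeg0 : ∀ v ∈ S, #(Finset.filter (fun e => v ∈ e) F) = 0 := fun v hvS => by
      rw [card_eq_zero, filter_eq_empty_iff]
      intro e he hve
      exact (mem_sdiff.1 ((mem_edgesIn_iff.1 (hFE he)).2 v hve)).2 hvS
    refine ⟨⟨⟨fun e he => SimpleGraph.mem_edgeFinset.2 (mem_edgesIn_iff.1 (hFE he)).1, fun v => ?_⟩,
      fun v hvS hr => ?_⟩, hFE⟩
    · by_cases hvS : v ∈ S
      · rw [hdeg0 v hvS]
        constructor
        · intro h
          exact absurd h Nat.not_odd_zero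
        · intro hv
          exact absurd hvS ((hoddv v).2 hv).1
      · rw [← hoddv v]
        exact ⟨fun h => ⟨hvS, h⟩, fun h => h.2⟩
    · have hvx : v ≠ x := fun h => hxS (h ▸ hvS)
      obtain ⟨e, he, hve⟩ := exists_mem_of_rch hr hvx
      exact (mem_sdiff.1 ((mem_edgesIn_iff.1 (hFE he)).2 v hve)).2 hvS
  · rintro ⟨⟨⟨hFG, hFodd⟩, havoid⟩, hFE⟩
    refine ⟨hFE, ?_⟩
    have hxy : (SimpleGraph.fromEdgeSet ((F : Finset (Sym2 V)) : Set (Sym2 V))).Reachable x y := rch_of_mem_tJoins_pair G ((mem_tJoins_univ G).2 ⟨hFG, hFodd⟩)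
    ext v
    rw [oddVerts, mem_filter, mem_sdiff, hFodd v]
    constructor
    · rintro ⟨-, h⟩
      exact h
    · intro hv
      refine ⟨⟨mem_univ _, fun hvS => ?_⟩, hv⟩
      rw [mem_insert, mem_singleton] at hv
      rcases hv with rfl | rfl
      · exact havoid v hvS (rch_refl F v)
      · exact havoid v hvS hxy

/-- **The depletion inequality for high-temperature sums**: with `t = tanh β`, `β ≥ 0`,
`(Σ_{F ∈ 𝒯(xy), K_x(F) avoids S} t^{|F|}) · g_{univ∖S}(∅) ≤ g_{univ∖S}({x,y}) · g_{univ}(∅)`.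
Termwise over the cluster index set this is the supermodularity
`g_{Λ_K}(∅) g_{univ∖S}(∅) ≤ g_{Λ_K∖S}(∅) g_{univ}(∅)`. -/
theorem sum_avoid_mul_hteSum_le {β : ℝ} (hβ : 0 ≤ β) (x y : V) (S : Finset V) :
    (∑ F ∈ (tJoins G Set.univ {x, y}).filter (fun F => ∀ v ∈ S, ¬ (SimpleGraph.fromEdgeSet ((F : Finset (Sym2 V)) : Set (Sym2 V))).Reachable x v),
        Real.tanh β ^ #F) * hteSum G (univ \ S) (Real.tanh β) ∅ ≤
      hteSum G (univ \ S) (Real.tanh β) {x, y} * hteSum G univ (Real.tanh β) ∅ := by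
  have ht0 : 0 ≤ Real.tanh β := Literature.Probability.LatticeModels.tanh_nonneg hβ
  rw [sum_avoid_eq_sum_fibres G x y S, Finset.sum_congr rfl (fun K hK => fibre_eval G hK _),
    hteSum_sdiff_pair_eq G x y S, Finset.sum_mul, Finset.sum_mul]
  refine Finset.sum_le_sum fun K hK => ?_
  have hKS : S ⊆ (Finset.filter (fun v => ¬ (SimpleGraph.fromEdgeSet ((K : Finset (Sym2 V)) : Set (Sym2 V))).Reachable x v) Finset.univ) := by
    rw [mem_filter] at hK
    intro v hv
    exact mem_dVol.2 (hK.2.2.2 v hv)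
  have hsm := hteSum_empty_supermodular G hβ (Finset.filter (fun v => ¬ (SimpleGraph.fromEdgeSet ((K : Finset (Sym2 V)) : Set (Sym2 V))).Reachable x v) Finset.univ) (univ \ S)
  have h1 : (Finset.filter (fun v => ¬ (SimpleGraph.fromEdgeSet ((K : Finset (Sym2 V)) : Set (Sym2 V))).Reachable x v) Finset.univ) ∩ (univ \ S) = (Finset.filter (fun v => ¬ (SimpleGraph.fromEdgeSet ((K : Finset (Sym2 V)) : Set (Sym2 V))).Reachable x v) Finset.univ) \ S := by
    ext v; simp only [mem_inter, mem_sdiff, mem_univ, true_and]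
  have h2 : (Finset.filter (fun v => ¬ (SimpleGraph.fromEdgeSet ((K : Finset (Sym2 V)) : Set (Sym2 V))).Reachable x v) Finset.univ) ∪ (univ \ S) = univ := by
    ext v
    simp only [mem_union, mem_sdiff, mem_univ, true_and, iff_true]
    by_cases hv : v ∈ S
    · exact Or.inl (hKS hv)
    · exact Or.inr hv
  rw [h1, h2] at hsm
  calc Real.tanh β ^ #K * hteSum G (Finset.filter (fun v => ¬ (SimpleGraph.fromEdgeSet ((K : Finset (Sym2 V)) : Set (Sym2 V))).Reachable x v) Finset.univ) (Real.tanh β) ∅ * hteSum G (univ \ S) (Real.tanh β) ∅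
      = Real.tanh β ^ #K * (hteSum G (Finset.filter (fun v => ¬ (SimpleGraph.fromEdgeSet ((K : Finset (Sym2 V)) : Set (Sym2 V))).Reachable x v) Finset.univ) (Real.tanh β) ∅ * hteSum G (univ \ S) (Real.tanh β) ∅) := by
        ring
    _ ≤ Real.tanh β ^ #K * (hteSum G ((Finset.filter (fun v => ¬ (SimpleGraph.fromEdgeSet ((K : Finset (Sym2 V)) : Set (Sym2 V))).Reachable x v) Finset.univ) \ S) (Real.tanh β) ∅ * hteSum G univ (Real.tanh β) ∅) :=
        mul_le_mul_of_nonneg_left hsm (pow_nonneg ht0 _)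
    _ = Real.tanh β ^ #K * hteSum G ((Finset.filter (fun v => ¬ (SimpleGraph.fromEdgeSet ((K : Finset (Sym2 V)) : Set (Sym2 V))).Reachable x v) Finset.univ) \ S) (Real.tanh β) ∅ * hteSum G univ (Real.tanh β) ∅ := by
        ring

end Pair

end Summit.CriticalPhenomena.Ising3DConformalLimit.Theorems.DepletionBound

/-! ### The item -/

namespace Summit.CriticalPhenomena.Ising3DConformalLimit.Theorems

open Finset
open Literature.Probability.LatticeModels
open Summit.CriticalPhenomena.Ising3DConformalLimit.Theorems.DepletionBound

/-- **Item `DepletionBound` (stmt-CriticalPhenomena-14628), proved.** On every finite graph `G`,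
for `β ≥ 0`, `t = tanh β` and `x, y ∉ S`:
`(Σ_{F ∈ 𝒯(xy), K_x(F) ∩ S = ∅} t^{|F|}) · ⟨σ_xσ_y⟩^free_G ≤ Z^{xy}_t(G) · ⟨σ_xσ_y⟩^free_{G, univ∖S}`,
i.e. `ℓ^{xy}_G[the source cluster avoids S] ≤ ⟨σ_xσ_y⟩_{G∖S} / ⟨σ_xσ_y⟩_G`.
Proof: high-temperature expansion `⟨σ_A⟩^free_Λ = g_Λ(A)/g_Λ(∅)` (`isingCorr_free_eq_hteSum_div`),
`Z^{xy}_t = g_{univ}({x,y})` (`loopO1PartitionFunction_eq_hteSum`) and the depletion inequality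
`sum_avoid_mul_hteSum_le` (cluster fibration + Aizenman–Fernández supermodularity). -/
theorem depletionBound_proof :
    Summit.CriticalPhenomena.Ising3DConformalLimit.Theses.FKParityRobustness.DepletionBound := by
  unfold Summit.CriticalPhenomena.Ising3DConformalLimit.Theses.FKParityRobustness.DepletionBound
  intro V _ _ G _ β hβ x y S hx hy
  have hA : ({x, y} : Finset V) ⊆ univ \ S := by
    intro v hv
    rw [mem_insert, mem_singleton] at hv
    rcases hv with rfl | rfl
    · exact mem_sdiff.2 ⟨mem_univ _, hx⟩
    · exact mem_sdiff.2 ⟨mem_univ _, hy⟩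
  rw [isingCorr_free_eq_hteSum_div G univ β (subset_univ _),
    isingCorr_free_eq_hteSum_div G (univ \ S) β hA, loopO1PartitionFunction_eq_hteSum]
  have key := sum_avoid_mul_hteSum_le G hβ x y S
  have h0 := hteSum_empty_pos G univ β
  have h0' := hteSum_empty_pos G (univ \ S) β
  have hnum : 0 ≤ hteSum G univ (Real.tanh β) {x, y} :=
    hteSum_nonneg G _ (Literature.Probability.LatticeModels.tanh_nonneg hβ) _
  -- `L · (g(A)/g(∅)) = g(A) · (L/g(∅)) ≤ g(A) · (g'(A)/g'(∅))`
  rw [← mul_div_assoc, mul_comm _ (hteSum G univ (Real.tanh β) {x, y}), mul_div_assoc]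
  exact mul_le_mul_of_nonneg_left ((div_le_div_iff₀ h0 h0').2 key) hnum

end Summit.CriticalPhenomena.Ising3DConformalLimit.Theorems

end
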